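import Literature.AnabelianGeometry.EtaleTheta.Discharge.Sec2AutKNormalizersC
import Literature.AnabelianGeometry.EtaleTheta.Discharge.Sec2AutKPairing
import Literature.AnabelianGeometry.EtaleTheta.Discharge.Sec2DoubleCoverProofs

/-!
# [EtTh] Remark 2.6.1 on the profinite side, II: the normaliser `N_{Π_C}(Π_{X̲̲}) = Π_{C̲}`
# (proof-only companion)

Mochizuki, *The Étale Theta Function …* [EtTh], Publ. RIMS 45 (2009), §2, Remark 2.6.1, PRIMS text
p.40 (printed p.266; locators = PDF pages; bib key `MochizukiEtTh2009`): "`Aut_K(X̲̲^log) = μ_l × {±1}`"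
[cite: MochizukiEtTh2009, Rmk 2.6.1 p.40].

Cell abc-iut, layer L2, discharge seat abc-iut-L2-d3 (node EtTh:Rmk2.6.1); continuation of
`Sec2AutKNormalizersC.lean`. For construction data `(H' = Π_{C̲}, E, S, ι̲)` of `Π_{C̲̲} = ⟨S·E, ι̲⟩` over
`X : CoverDataAx l`, with `Π_{X̲̲} = S·E`:

* `le_normalizer_sup_eigen` — `Π_{C̲} ⊆ N_{Π_C}(Π_{X̲̲})` under `μ_l ⊆ K` (`hmu`), using Prop 2.2 (iii)
  (`ι̲` normalises `S·E`, abc-iut-L2-t10's `inversion_conj_mem_sup`);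
* `normalizer_sup_eigen_le` — `N_{Π_C}(Π_{X̲̲}) ⊆ Π_{C̲}` under the printed definition
  `hΘ : [Δ_X, Δ_X]·Ker = Δ̄_Θ`-preimage (p.35), via the non-degeneracy of the commutator pairing
  (`Sec2AutKPairing.mem_of_commutator_mem_barKer`);
* `normalizer_sup_eigen_eq` — **`N_{Π_C}(Π_{X̲̲}) = Π_{C̲}`**.

No new definition, no named fact; nothing asserts that a `CoverDataAx` exists; no side is taken on any
disputed claim.
-/

namespace Literature.AnabelianGeometry.EtaleTheta

namespace ThetaCovers

namespace CoverDataAx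

open scoped commutatorElement

universe u

variable {l : ℕ} (X : CoverDataAx.{u} l)

section Data

variable {H' E S : Subgroup X.PiC} {ι : X.PiC}

/-! ### `N_{Π_C}(Π_{X̲̲}) = Π_{C̲}` -/


/-- `Π_{C̲} ⊆ N_{Π_C}(Π_{X̲̲})` under `μ_l ⊆ K`: `Π_{X̲̲} = S·E` is normal in `Π_{C̲̲} = ⟨S·E, ι̲⟩` (index `2`,
Prop 2.2 (iii)) and is normalised by `Δ̄_Θ`-preimage. [cite: MochizukiEtTh2009, Rmk 2.6.1 p.40] -/
theorem le_normalizer_sup_eigen (hmu : ∀ c : X.PiC, ∀ t ∈ X.barTheta, c * t * c⁻¹ * t⁻¹ ∈ X.barKer)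
    (hH' : X.toCoverData.IsTypeLTorsPm H') (hι : X.toCoverData.IsInversion H' ι) (h2 : ι * ι ∈ X.barKer)
    (hE : X.toCoverData.IsMinusEigen (H' ⊓ X.PiX) H' ι E) (hS : X.toCoverData.IsSplitting S) :
    H' ≤ Subgroup.normalizer ((S ⊔ E : Subgroup X.PiC) : Set X.PiC) := by
  conv_lhs => rw [← X.sup_zpowers_sup_barTheta_eq hH' hι hE hS]
  refine sup_le (sup_le Subgroup.le_normalizer ?_) (le_normalizer_of_conj_mem fun t ht p hp => ?_)
  · rw [Subgroup.zpowers_le, Subgroup.mem_normalizer_iff]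
    intro p
    constructor
    · exact fun hp => X.inversion_conj_mem_sup hH' rfl hι hE hS h2 hp
    · intro hp
      have hι' : ι⁻¹ = ι * (ι * ι)⁻¹ := by group
      have := X.inversion_conj_mem_sup hH' rfl hι hE hS h2 hp
      have e : ι * (ι * p * ι⁻¹) * ι⁻¹ = (ι * ι) * p * (ι * ι)⁻¹ := by group
      rw [e] at this
      have hιι : ι * ι ∈ S ⊔ E := Subgroup.mem_sup_right (hE.barKer_le h2)
      exact (Subgroup.mul_mem_cancel_left (S ⊔ E) hιι).mp
        ((Subgroup.mul_mem_cancel_right (S ⊔ E) (Subgroup.inv_mem _ hιι)).mp this)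
  · exact X.barTheta_conj_mem hmu (hS.barKer_le.trans le_sup_left) ht hp

/-- `N_{Π_C}(Π_{X̲̲}) ⊆ Π_{C̲}` under the printed definition `hΘ : [Δ_X, Δ_X]·Ker = Δ̄_Θ`-preimage (p.35): a
normaliser `g` of `S·E` normalises `(S·E) ∩ Δ_C = E`; writing `g = y·a` with `y ∈ Π_{C̲}` (which normalises
`E`) and `a ∈ Δ_X`, the element `a` centralises `E·Δ̄_Θ = Δ_{X̲}` modulo `Ker`, hence `a ∈ Δ_{X̲}` by the
non-degeneracy of the commutator pairing (`mem_of_commutator_mem_barKer`).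
[cite: MochizukiEtTh2009, Rmk 2.6.1 p.40] -/
theorem normalizer_sup_eigen_le (hΘ : ⁅X.DeltaX, X.DeltaX⁆ ⊔ X.barKer = X.barTheta)
    (hH' : X.toCoverData.IsTypeLTorsPm H') (hι : X.toCoverData.IsInversion H' ι)
    (hE : X.toCoverData.IsMinusEigen (H' ⊓ X.PiX) H' ι E) (hS : X.toCoverData.IsSplitting S) :
    Subgroup.normalizer ((S ⊔ E : Subgroup X.PiC) : Set X.PiC) ≤ H' := by
  haveI := X.PiX_normal
  haveI : X.DeltaX.Normal := inferInstance
  haveI := X.barTheta_normal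
  haveI := X.barKer_normal
  have hT := hH'.inf_isTypeLTors
  intro g hg
  -- `g` normalises `E = (S·E) ∩ Δ_C`
  have hgE : g ∈ Subgroup.normalizer ((E : Subgroup X.PiC) : Set X.PiC) := by
    have := normalizer_le_normalizer_inf (S ⊔ E) X.DeltaC hg
    rwa [X.splitting_sup_eigen_inf_deltaC hH' rfl hE hS] at this
  -- `g = y a`, `y ∈ Π_{C̲}`, `a ∈ Δ_X`
  have hg' : g ∈ H' ⊔ X.DeltaX := by rw [X.sup_deltaX_eq_top hH' hι]; exact Subgroup.mem_top g
  obtain ⟨y, hy, a, ha, rfl⟩ := Subgroup.mem_sup_of_normal_right.mp hg'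
  have hyE := X.le_normalizer_eigen hι hE hy
  have haE : a ∈ Subgroup.normalizer ((E : Subgroup X.PiC) : Set X.PiC) := by
    have := Subgroup.mul_mem _ (Subgroup.inv_mem _ hyE) hgE
    rwa [inv_mul_cancel_left] at this
  -- `a` commutes with `Δ_{X̲} = E·Δ̄_Θ` modulo `Ker`
  have hcomm : ∀ d : X.PiC, d ∈ H' ⊓ X.PiX → d ∈ X.DeltaX → ⁅a, d⁆ ∈ X.barKer := by
    intro d hdH hdΔ
    have hd : d ∈ E ⊔ X.barTheta := by rw [hE.sup_eq]; exact ⟨hdH, hdΔ.2⟩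
    obtain ⟨e, he, t, ht, rfl⟩ := Subgroup.mem_sup_of_normal_right.mp hd
    have hae : ⁅a, e⁆ ∈ X.barKer := by
      rw [← hE.inf_eq]
      refine ⟨?_, X.commutator_deltaX_le_barTheta (Subgroup.commutator_mem_commutator ha
        ⟨hT.le (hE.le he).1, (hE.le he).2⟩)⟩
      rw [commutatorElement_def]
      exact Subgroup.mul_mem _ ((Subgroup.mem_normalizer_iff.mp haE e).mp he) (Subgroup.inv_mem _ he)
    have heΔ : e ∈ X.DeltaX := ⟨hT.le (hE.le he).1, (hE.le he).2⟩
    rw [← QuotientGroup.eq_one_iff, ClassTwo.mk_commutator_mul_right X.DeltaX X.barTheta X.barKer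
      X.commutator_deltaX_le_barTheta X.commutator_deltaX_barTheta_le_barKer ha heΔ (X.barTheta_le ht),
      (QuotientGroup.eq_one_iff _).mpr hae, one_mul, X.mk_commutator_barTheta_right ha ht]
  have haH : a ∈ H' ⊓ X.PiX := X.mem_of_commutator_mem_barKer hΘ hT ha hcomm
  exact Subgroup.mul_mem _ hy haH.1

/-- **`N_{Π_C}(Π_{X̲̲}) = Π_{C̲}`** under `μ_l ⊆ K` and the printed definition of `Δ̄_Θ`.
[cite: MochizukiEtTh2009, Rmk 2.6.1 p.40] -/
theorem normalizer_sup_eigen_eq (hΘ : ⁅X.DeltaX, X.DeltaX⁆ ⊔ X.barKer = X.barTheta)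
    (hmu : ∀ c : X.PiC, ∀ t ∈ X.barTheta, c * t * c⁻¹ * t⁻¹ ∈ X.barKer)
    (hH' : X.toCoverData.IsTypeLTorsPm H') (hι : X.toCoverData.IsInversion H' ι) (h2 : ι * ι ∈ X.barKer)
    (hE : X.toCoverData.IsMinusEigen (H' ⊓ X.PiX) H' ι E) (hS : X.toCoverData.IsSplitting S) :
    Subgroup.normalizer ((S ⊔ E : Subgroup X.PiC) : Set X.PiC) = H' :=
  le_antisymm (X.normalizer_sup_eigen_le hΘ hH' hι hE hS) (X.le_normalizer_sup_eigen hmu hH' hι h2 hE hS)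

end Data

end CoverDataAx

end ThetaCovers

end Literature.AnabelianGeometry.EtaleTheta
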